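import Literature.NumberTheory.LFunctions.WeilMarkovQuadratic
import Literature.NumberTheory.LFunctions.WeilWindowSuzukiProofs
import Literature.NumberTheory.LFunctions.WeilWindowSuzukiAsymptoticProofs
import Mathlib.Analysis.SpecialFunctions.Sqrt

/-!
# Sub-stub `stub_edgeLaw_surplus` of stub `stub_edgeLaw` of line `cut-dont-squeeze` for crux `WeilWindowFlow.WindowLipschitz`
(item stmt-RiemannHypothesis-1039, route route-RiemannHypothesis-WeilWindowFlow; registered skeleton rev 4,
`Summits/RiemannHypothesis/RiemannHypothesis/Cruxes/WindowLipschitz/Lines/cut-dont-squeeze.lean`)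

The **borderline barrier surplus** (pure real analysis): for `W̃(s) = (log(1/min(s,d₀)))^{-1/2}`
(`s > 0`; `0` for `s ≤ 0`), `ρ = weilArchDensity`, `0 < d < d₀ ≤ 1/16`, `2d₀ ≤ δ ≤ 1`:
`∫_{(0,δ]} ρ(t) (2W̃(d) − W̃(d−t) − W̃(d+t)) dt ≥ ½ √(log(1/d₀)) − 4 (1 + log(1/δ))`.
Route (`W(s) = (log(1/s))^{-1/2}`, `L = log(1/d) ≥ L₀ = log(1/d₀) ≥ log 16`, `Λ = log(1/δ)`): the
kernel expansion `|ρ(t) − 1/(2t)| ≤ 1` on `(0,1]` (`abs_weilArchDensity_sub_le`); the chord-slope bound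
`0 ≤ W(y) − W(x) ≤ (y − x)/(2x ℓ√ℓ)`, `ℓ = log(1/y)` (`surplus_W_sub_le`, from `log(y/x) ≤ y/x − 1`),
which bounds the integrand (integrability) and shows that on `(0, d]` only the inward pull is
negative, of total size `≤ 1/8`; on `(d, δ]` the pointwise bound
`ρ(2W(d) − W̃(d+t)) ≥ W(d)/t − Ŵ(t)/(2t) − 3W(d₀)`, `Ŵ(t) = W(min(2t, d₀))`; and the exact integrals
`W(d)∫_d^δ dt/t = √L − Λ/√L`, `∫_d^{d₀/2} W(2t) dt/(2t) = √(log(1/(2d))) − √L₀ ≤ √L − √L₀`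
(antiderivative `−√(log(1/(2t)))`, `surplus_integral_model`): the critical `√L` cancel and
`½√L₀ − Λ/(2√L₀) − O(1)` survives. Model computation in print: Hernández-Santamaría–López-Ríos–Saldaña,
arXiv:2401.18033, Thm 2.4 (logarithmic Laplacian of `(log(1/dist))^{-1/2}` barriers).
-/

set_option linter.dupNamespace false

noncomputable section

open MeasureTheory Set Filter Real
open scoped Topology ENNReal NNReal ComplexConjugate

namespace Summit.RiemannHypothesis.RiemannHypothesis.Theorems.WeilWindowFlowWindowLipschitz

open Literature.NumberTheory.LFunctions

/-- For `0 < x ≤ 1/16`, with `ℓ = log(1/x) ≥ log 16 ≥ 2.77`: `1.6 ≤ √ℓ`, `4 ≤ ℓ √ℓ`, `W(x) ≤ 5/8`. -/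
private theorem surplus_ell_bounds {x : ℝ} (hx : 0 < x) (hx' : x ≤ 1 / 16) :
    1.6 ≤ √(log (1 / x)) ∧ 4 ≤ log (1 / x) * √(log (1 / x)) ∧ (√(log (1 / x)))⁻¹ ≤ 5 / 8 := by
  have hl16 : (2.77 : ℝ) ≤ log 16 := by
    rw [show (16 : ℝ) = 2 ^ 4 by norm_num, Real.log_pow]; push_cast; linarith [Real.log_two_gt_d9]
  have h16 : log 16 ≤ log (1 / x) := by
    refine Real.log_le_log (by norm_num) ?_
    rw [le_one_div (by norm_num) hx]; simpa using hx'
  have hs : 1.6 ≤ √(log (1 / x)) := (Real.le_sqrt_of_sq_le (by nlinarith)).trans (Real.sqrt_le_sqrt h16)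
  refine ⟨hs, by nlinarith, ?_⟩
  rw [inv_le_comm₀ (by positivity) (by norm_num)]
  norm_num at hs ⊢
  linarith

/-- `W(x) = (log(1/x))^{-1/2}` is non-decreasing on `(0, 1)`. -/
private theorem surplus_W_mono {x y : ℝ} (hx : 0 < x) (hxy : x ≤ y) (hy : y < 1) :
    (√(log (1 / x)))⁻¹ ≤ (√(log (1 / y)))⁻¹ := by
  refine inv_anti₀ (Real.sqrt_pos.2 (Real.log_pos (one_lt_one_div (hx.trans_le hxy) hy)))
    (Real.sqrt_le_sqrt ?_)
  exact Real.log_le_log (one_div_pos.2 (hx.trans_le hxy)) (one_div_le_one_div_of_le hx hxy)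

/-- Chord slopes of `W`: `W(y) − W(x) ≤ (y − x) / (2 x ℓ √ℓ)`, `ℓ = log(1/y)`, for `0 < x ≤ y < 1`
(`1/v − 1/u ≤ (u² − v²)/(2v³)` for `0 < v ≤ u`, and `log(y/x) ≤ y/x − 1`). -/
private theorem surplus_W_sub_le {x y : ℝ} (hx : 0 < x) (hxy : x ≤ y) (hy : y < 1) :
    (√(log (1 / y)))⁻¹ - (√(log (1 / x)))⁻¹ ≤ (y - x) / (2 * x * (log (1 / y) * √(log (1 / y)))) := by
  have hy0 : 0 < y := hx.trans_le hxy
  have hly : 0 < log (1 / y) := Real.log_pos (one_lt_one_div hy0 hy)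
  have hlxy : log (1 / y) ≤ log (1 / x) :=
    Real.log_le_log (one_div_pos.2 hy0) (one_div_le_one_div_of_le hx hxy)
  set u := √(log (1 / x))
  set v := √(log (1 / y))
  have hv0 : 0 < v := Real.sqrt_pos.2 hly
  have huv : v ≤ u := Real.sqrt_le_sqrt hlxy
  have hu0 : 0 < u := hv0.trans_le huv
  have hvv : v ^ 2 = log (1 / y) := Real.sq_sqrt hly.le
  have huu : u ^ 2 = log (1 / x) := Real.sq_sqrt (hly.le.trans hlxy)
  have hdiff : log (1 / x) - log (1 / y) ≤ (y - x) / x := by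
    rw [← Real.log_div (by positivity) (by positivity), show 1 / x / (1 / y) = y / x by field_simp,
      show (y - x) / x = y / x - 1 by field_simp]
    exact Real.log_le_sub_one_of_pos (by positivity)
  have key : v⁻¹ - u⁻¹ ≤ (u ^ 2 - v ^ 2) / (2 * v ^ 3) := by
    rw [inv_sub_inv hv0.ne' hu0.ne', div_le_div_iff₀ (by positivity) (by positivity)]
    nlinarith [mul_nonneg (mul_nonneg (sq_nonneg (u - v)) hv0.le)
      (add_pos hu0 (mul_pos two_pos hv0)).le]
  rw [show log (1 / y) * v = v ^ 3 by rw [← hvv]; ring]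
  calc v⁻¹ - u⁻¹ ≤ (u ^ 2 - v ^ 2) / (2 * v ^ 3) := key
    _ ≤ ((y - x) / x) / (2 * v ^ 3) := by gcongr; rw [huu, hvv]; exact hdiff
    _ = (y - x) / (2 * x * v ^ 3) := by field_simp

/-- The kernel on `(0, 1]`: `1/(2t) − 1 ≤ ρ(t) ≤ 1/(2t) + 1`. -/
private theorem surplus_rho_bounds {t : ℝ} (ht : 0 < t) (ht1 : t ≤ 1) :
    t⁻¹ / 2 - 1 ≤ weilArchDensity t ∧ weilArchDensity t ≤ t⁻¹ / 2 + 1 := by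
  have h := abs_le.1 (abs_weilArchDensity_sub_le ht ht1)
  rw [show 1 / (2 * t) = t⁻¹ / 2 by field_simp] at h
  constructor <;> linarith [h.1, h.2]

/-- Continuity of the model integrand `W(2t)/(2t)` on `[a, b]`, `0 < a`, `2b < 1`. -/
private theorem surplus_model_continuousOn {a b : ℝ} (ha : 0 < a) (hb : 2 * b < 1) :
    ContinuousOn (fun t : ℝ ↦ (√(log (1 / (2 * t))))⁻¹ / (2 * t)) (Icc a b) := by
  have h2t : ∀ t ∈ Icc a b, (2 : ℝ) * t ≠ 0 := fun t ht ↦ by linarith [ha.trans_le ht.1]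
  have hpos : ∀ t ∈ Icc a b, 0 < log (1 / (2 * t)) := fun t ht ↦
    Real.log_pos (one_lt_one_div (by linarith [ha.trans_le ht.1]) (by linarith [ht.2]))
  refine ContinuousOn.div ?_ (continuousOn_const.mul continuousOn_id) h2t
  exact ContinuousOn.inv₀ (ContinuousOn.sqrt (ContinuousOn.log
    (continuousOn_const.div (continuousOn_const.mul continuousOn_id) h2t) fun t ht ↦
      (one_div_pos.2 (by linarith [ha.trans_le ht.1])).ne'))
    fun t ht ↦ (Real.sqrt_pos.2 (hpos t ht)).ne'

/-- The model integral `∫_{(a,b]} W(2t) dt/(2t) = √(log(1/(2a))) − √(log(1/(2b)))` for `0 < a ≤ b`,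
`2b < 1` (antiderivative `−√(log(1/(2t)))`). -/
private theorem surplus_integral_model {a b : ℝ} (ha : 0 < a) (hab : a ≤ b) (hb : 2 * b < 1) :
    ∫ t in Ioc a b, (√(log (1 / (2 * t))))⁻¹ / (2 * t) =
      √(log (1 / (2 * a))) - √(log (1 / (2 * b))) := by
  have hφ : ∀ t : ℝ, 0 < t → -log 2 - log t = log (1 / (2 * t)) := fun t ht ↦ by
    rw [one_div, Real.log_inv, Real.log_mul two_ne_zero ht.ne']; ring
  have hφpos : ∀ t : ℝ, 0 < t → t ≤ b → 0 < log (1 / (2 * t)) := fun t ht htb ↦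
    Real.log_pos (one_lt_one_div (by positivity) (by linarith))
  have hderiv : ∀ t ∈ uIcc a b, HasDerivAt (fun t ↦ -√(-log 2 - log t))
      (-(-t⁻¹ / (2 * √(-log 2 - log t)))) t := by
    intro t ht
    have ht' : t ∈ Icc a b := uIcc_of_le hab ▸ ht
    have hne : -log 2 - log t ≠ 0 := by
      rw [hφ t (ha.trans_le ht'.1)]; exact (hφpos t (ha.trans_le ht'.1) ht'.2).ne'
    exact (((Real.hasDerivAt_log (ha.trans_le ht'.1).ne').const_sub (-log 2)).sqrt hne).neg
  have heq : EqOn (fun t : ℝ ↦ -(-t⁻¹ / (2 * √(-log 2 - log t))))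
      (fun t ↦ (√(log (1 / (2 * t))))⁻¹ / (2 * t)) (uIcc a b) := by
    intro t ht
    simp only [hφ t (ha.trans_le (uIcc_of_le hab ▸ ht : t ∈ Icc a b).1)]
    field_simp
  have hFTC := intervalIntegral.integral_eq_sub_of_hasDerivAt hderiv
    ((surplus_model_continuousOn ha hb).intervalIntegrable_of_Icc hab |>.congr
      fun t ht ↦ (heq (uIoc_subset_uIcc ht)).symm)
  rw [intervalIntegral.integral_congr heq] at hFTC
  rw [← intervalIntegral.integral_of_le hab, hFTC, ← hφ a ha, ← hφ b (ha.trans_le hab)]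
  ring

/-- Pointwise algebra on `(0, d]`: only the inward pull can be negative, and it is `O(1/d)`. -/
private theorem surplus_alg0 {t d ρ Wd A B : ℝ} (ht : 0 < t) (htd : t ≤ d) (hρ0 : 0 ≤ ρ)
    (hρ1 : ρ ≤ t⁻¹ / 2 + 1) (hA : A ≤ Wd) (hB : B - Wd ≤ t / (8 * d)) :
    -(1 / (16 * d) + 1 / 8) ≤ ρ * (2 * Wd - A - B) := by
  have hd : 0 < d := ht.trans_le htd
  have h1 : 0 ≤ ρ * (Wd - A) := mul_nonneg hρ0 (sub_nonneg.2 hA)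
  have h2 : 0 ≤ ρ * (Wd - B + t / (8 * d)) := mul_nonneg hρ0 (by linarith)
  have h3 : 0 ≤ (t⁻¹ / 2 + 1 - ρ) * (t / (8 * d)) := mul_nonneg (sub_nonneg.2 hρ1) (by positivity)
  have h4 : (t⁻¹ / 2 + 1) * (t / (8 * d)) = 1 / (16 * d) + t / (8 * d) := by field_simp; ring
  have h5 : t / (8 * d) ≤ 1 / 8 := by rw [div_le_div_iff₀ (by positivity) (by norm_num)]; linarith
  nlinarith

/-- Pointwise algebra on `(d, δ]`: `ρ (2W(d) − B) ≥ W(d)/t − B̂/(2t) − 3w₀`. -/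
private theorem surplus_alg1 {t ρ Wd B Bh w₀ : ℝ} (ht : 0 < t) (hρ0 : t⁻¹ / 2 - 1 ≤ ρ)
    (hρ1 : ρ ≤ t⁻¹ / 2 + 1) (hW0 : 0 ≤ Wd) (hW1 : Wd ≤ w₀) (hB0 : 0 ≤ B) (hB1 : B ≤ Bh)
    (hB2 : B ≤ w₀) : Wd * t⁻¹ - Bh / (2 * t) - 3 * w₀ ≤ ρ * (2 * Wd - 0 - B) := by
  have h1 : 0 ≤ (ρ - (t⁻¹ / 2 - 1)) * Wd := mul_nonneg (sub_nonneg.2 hρ0) hW0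
  have h2 : 0 ≤ (t⁻¹ / 2 + 1 - ρ) * B := mul_nonneg (sub_nonneg.2 hρ1) hB0
  have h3 : 0 ≤ (Bh - B) * t⁻¹ := mul_nonneg (sub_nonneg.2 hB1) (inv_pos.2 ht).le
  rw [show Bh / (2 * t) = Bh * t⁻¹ / 2 by field_simp]
  nlinarith

/-- A minorant `κ t⁻¹ − c/(2t) − m` on `(a, b]` integrates to `(κ − c/2)(log(1/a) − log(1/b)) − m (b − a)`. -/
private theorem surplus_block1 {F : ℝ → ℝ} {a b κ c m : ℝ} (ha : 0 < a) (hab : a ≤ b)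
    (hF : IntegrableOn F (Ioc a b)) (h : ∀ t ∈ Ioc a b, κ * t⁻¹ - c / (2 * t) - m ≤ F t) :
    (κ - c / 2) * (log (1 / a) - log (1 / b)) - m * (b - a) ≤ ∫ t in Ioc a b, F t := by
  have hb : 0 < b := ha.trans_le hab
  rw [show log (1 / a) - log (1 / b) = log b - log a by
    rw [one_div, one_div, Real.log_inv, Real.log_inv]; ring]
  have hc1 : ContinuousOn (fun t : ℝ ↦ (κ - c / 2) * t⁻¹) (Icc a b) :=
    continuousOn_const.mul (continuousOn_id.inv₀ fun t ht ↦ (ha.trans_le ht.1).ne')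
  have hGi : IntegrableOn (fun t : ℝ ↦ (κ - c / 2) * t⁻¹ - m) (Ioc a b) :=
    (hc1.sub continuousOn_const).integrableOn_Icc.mono_set Ioc_subset_Icc_self
  have hmono := setIntegral_mono_on hGi hF measurableSet_Ioc fun t ht ↦ by
    have := h t ht; rw [show c / (2 * t) = c / 2 * t⁻¹ by ring] at this; linarith
  have hi2 : IntervalIntegrable (fun _ : ℝ ↦ m) volume a b := intervalIntegrable_const
  have hev : ∫ t in Ioc a b, ((κ - c / 2) * t⁻¹ - m) =
      (κ - c / 2) * (log b - log a) - m * (b - a) := by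
    rw [← intervalIntegral.integral_of_le hab, intervalIntegral.integral_sub
      (hc1.intervalIntegrable_of_Icc hab) hi2, intervalIntegral.integral_const_mul,
      integral_inv_of_pos ha hb, intervalIntegral.integral_const, Real.log_div hb.ne' ha.ne',
      smul_eq_mul]
    ring
  linarith

/-- A minorant `κ t⁻¹ − W(2t)/(2t) − m` on `(a, b]` (`2b < 1`). -/
private theorem surplus_block2 {F : ℝ → ℝ} {a b κ m : ℝ} (ha : 0 < a) (hab : a ≤ b)
    (hb : 2 * b < 1) (hF : IntegrableOn F (Ioc a b))
    (h : ∀ t ∈ Ioc a b, κ * t⁻¹ - (√(log (1 / (2 * t))))⁻¹ / (2 * t) - m ≤ F t) :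
    κ * (log (1 / a) - log (1 / b)) - (√(log (1 / (2 * a))) - √(log (1 / (2 * b)))) - m * (b - a) ≤
      ∫ t in Ioc a b, F t := by
  have hGi : IntegrableOn (fun t : ℝ ↦ (√(log (1 / (2 * t))))⁻¹ / (2 * t)) (Ioc a b) :=
    (surplus_model_continuousOn ha hb).integrableOn_Icc.mono_set Ioc_subset_Icc_self
  have h1 := surplus_block1 (F := fun t ↦ F t + (√(log (1 / (2 * t))))⁻¹ / (2 * t))
    (κ := κ) (c := 0) (m := m) ha hab (hF.add hGi) fun t ht ↦ by
      rw [zero_div, sub_zero]; linarith [h t ht]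
  rw [integral_add hF hGi, surplus_integral_model ha hab hb, zero_div, sub_zero] at h1
  linarith

/-- Values of `W` on `(0, 1/16]` lie in `[0, 1]`. -/
private theorem surplus_W01 {x : ℝ} (hx : 0 < x) (hx' : x ≤ 1 / 16) :
    0 ≤ (√(log (1 / x)))⁻¹ ∧ (√(log (1 / x)))⁻¹ ≤ 1 :=
  ⟨inv_nonneg.2 (Real.sqrt_nonneg _), (surplus_ell_bounds hx hx').2.2.trans (by norm_num)⟩

/-- The inward increment: `0 ≤ W(min(d+t,d₀)) − W(d) ≤ t/(8d)`. -/
private theorem surplus_B_bound {d d₀ t : ℝ} (hd : 0 < d) (hdd₀ : d < d₀) (hd₀ : d₀ ≤ 1 / 16)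
    (ht : 0 < t) :
    0 ≤ (√(log (1 / min (d + t) d₀)))⁻¹ - (√(log (1 / d)))⁻¹ ∧
      (√(log (1 / min (d + t) d₀)))⁻¹ - (√(log (1 / d)))⁻¹ ≤ t / (8 * d) := by
  have hy : d ≤ min (d + t) d₀ := le_min (by linarith) hdd₀.le
  have hy16 : min (d + t) d₀ ≤ 1 / 16 := (min_le_right _ _).trans hd₀
  have hy1 : min (d + t) d₀ < 1 := by linarith
  refine ⟨sub_nonneg.2 (surplus_W_mono hd hy hy1), (surplus_W_sub_le hd hy hy1).trans ?_⟩
  have hP := (surplus_ell_bounds (hd.trans_le hy) hy16).2.1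
  refine div_le_div₀ ht.le (by linarith [min_le_left (d + t) d₀]) (by positivity) ?_
  nlinarith [mul_nonneg hd.le (sub_nonneg.2 hP)]

/-- Pointwise lower bound on `(0, d]`. -/
private theorem surplus_pt0 {d d₀ t : ℝ} (hd : 0 < d) (hdd₀ : d < d₀) (hd₀ : d₀ ≤ 1 / 16)
    (ht : 0 < t) (htd : t ≤ d) :
    -(1 / (16 * d) + 1 / 8) ≤ weilArchDensity t * (2 * (√(log (1 / min d d₀)))⁻¹
      - (if d - t ≤ 0 then 0 else (√(log (1 / min (d - t) d₀)))⁻¹) - (√(log (1 / min (d + t) d₀)))⁻¹) := by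
  have hρ := surplus_rho_bounds ht (by linarith)
  rw [min_eq_left hdd₀.le]
  refine surplus_alg0 ht htd (weilArchDensity_pos ht).le hρ.2 ?_ (surplus_B_bound hd hdd₀ hd₀ ht).2
  split_ifs with h
  · exact inv_nonneg.2 (Real.sqrt_nonneg _)
  · rw [min_eq_left (by linarith : d - t ≤ d₀)]
    exact surplus_W_mono (by linarith) (by linarith) (by linarith)

/-- Pointwise lower bound on `(d, 1]`: `ρ(2W(d) − W̃(d+t)) ≥ W(d)/t − B̂/(2t) − 3W(d₀)` for any
majorant `B̂ ≥ W̃(d+t)` (used with `B̂ = W(d₀)` and, for `t ≤ d₀/2`, with `B̂ = W(2t)`). -/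
private theorem surplus_pt1 {d d₀ t Bh : ℝ} (hd : 0 < d) (hdd₀ : d < d₀) (hd₀ : d₀ ≤ 1 / 16)
    (hdt : d < t) (ht1 : t ≤ 1) (hBh : (√(log (1 / min (d + t) d₀)))⁻¹ ≤ Bh) :
    (√(log (1 / d)))⁻¹ * t⁻¹ - Bh / (2 * t) - 3 * (√(log (1 / d₀)))⁻¹ ≤
      weilArchDensity t * (2 * (√(log (1 / min d d₀)))⁻¹
        - (if d - t ≤ 0 then 0 else (√(log (1 / min (d - t) d₀)))⁻¹) - (√(log (1 / min (d + t) d₀)))⁻¹) := by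
  have ht : 0 < t := hd.trans hdt
  have hρ := surplus_rho_bounds ht ht1
  rw [min_eq_left hdd₀.le, if_pos (by linarith : d - t ≤ 0)]
  exact surplus_alg1 ht hρ.1 hρ.2 (inv_nonneg.2 (Real.sqrt_nonneg _))
    (surplus_W_mono hd hdd₀.le (by linarith)) (inv_nonneg.2 (Real.sqrt_nonneg _)) hBh
    (surplus_W_mono (lt_min (by linarith) (hd.trans hdd₀)) (min_le_right _ _) (by linarith))

/-- The surplus integrand is bounded by `2/d + 3` on `(0, δ]` (below by `surplus_pt0`/`surplus_pt1`,
above dropping the non-positive inward part and using `ρ ≤ 1/(2t) + 1`), hence integrable there. -/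
private theorem surplus_integrableOn {d d₀ δ : ℝ} (hd : 0 < d) (hdd₀ : d < d₀) (hd₀ : d₀ ≤ 1 / 16)
    (hδ1 : δ ≤ 1) : IntegrableOn (fun t : ℝ ↦ weilArchDensity t * (2 * (√(log (1 / min d d₀)))⁻¹
      - (if d - t ≤ 0 then 0 else (√(log (1 / min (d - t) d₀)))⁻¹) - (√(log (1 / min (d + t) d₀)))⁻¹))
      (Ioc 0 δ) := by
  have hWm : ∀ {f : ℝ → ℝ}, Measurable f → Measurable fun t ↦ (√(log (1 / f t)))⁻¹ :=
    fun hf ↦ ((measurable_const.div hf).log.sqrt).inv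
  refine Measure.integrableOn_of_bounded measure_Ioc_lt_top.ne
    (measurable_weilArchDensity.mul ((measurable_const.sub (Measurable.ite
      (measurableSet_le (measurable_const.sub measurable_id) measurable_const) measurable_const
      (hWm ((measurable_const.sub measurable_id).min measurable_const)))).sub
      (hWm ((measurable_const.add measurable_id).min measurable_const)))).aestronglyMeasurable
    (M := 2 * (1 / d) + 3) ((ae_restrict_iff' measurableSet_Ioc).2 (ae_of_all _ fun t htI ↦ ?_))
  obtain ⟨ht, ht1⟩ : 0 < t ∧ t ≤ 1 := ⟨htI.1, htI.2.trans hδ1⟩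
  have hρ := surplus_rho_bounds ht ht1
  have hρ0 := (weilArchDensity_pos ht).le
  have hW := surplus_W01 hd (by linarith)
  have hw₀ := surplus_W01 (hd.trans hdd₀) hd₀
  have hm0 : 0 < min (d + t) d₀ := lt_min (by linarith) (hd.trans hdd₀)
  have hB := surplus_W01 hm0 ((min_le_right (d + t) d₀).trans hd₀)
  have h16 : 16 ≤ 1 / d := by rw [le_one_div (by norm_num) hd]; linarith
  rw [Real.norm_eq_abs, abs_le, min_eq_left hdd₀.le]
  constructor
  · rcases le_or_gt t d with htd | htd
    · have h := surplus_pt0 hd hdd₀ hd₀ ht htd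
      rw [min_eq_left hdd₀.le, show 1 / (16 * d) = 1 / d / 16 by ring] at h
      linarith
    · have h := surplus_pt1 hd hdd₀ hd₀ htd ht1 (surplus_W_mono hm0 (min_le_right _ _) (by linarith))
      rw [min_eq_left hdd₀.le, show (√(log (1 / d₀)))⁻¹ / (2 * t) = (√(log (1 / d₀)))⁻¹ * t⁻¹ / 2
        by ring] at h
      have hti : t⁻¹ ≤ 1 / d := by rw [one_div]; exact inv_anti₀ hd htd.le
      linarith [mul_le_mul hw₀.2 hti (inv_pos.2 ht).le zero_le_one,
        mul_nonneg hW.1 (inv_pos.2 ht).le]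
  · rcases le_or_gt t (d / 2) with htd | htd
    · rw [if_neg (by linarith), min_eq_left (by linarith : d - t ≤ d₀)]
      -- the outward increment near `0`: `0 ≤ W(d) − W(d − t) ≤ t/(4d)`
      have hx : 0 < d - t := by linarith
      have hA1 : 0 ≤ (√(log (1 / d)))⁻¹ - (√(log (1 / (d - t))))⁻¹ :=
        sub_nonneg.2 (surplus_W_mono hx (by linarith) (by linarith))
      have hA2 : (√(log (1 / d)))⁻¹ - (√(log (1 / (d - t))))⁻¹ ≤ t / (4 * d) := by
        refine (surplus_W_sub_le hx (by linarith) (by linarith)).trans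
          (div_le_div₀ ht.le (by linarith) (by positivity) ?_)
        nlinarith [mul_nonneg hx.le (sub_nonneg.2 (surplus_ell_bounds hd (by linarith)).2.1)]
      have h1 := mul_nonneg hρ0 (surplus_B_bound hd hdd₀ hd₀ ht).1
      have h2 := mul_le_mul hρ.2 hA2 hA1 (by positivity)
      have h3 : (t⁻¹ / 2 + 1) * (t / (4 * d)) = 1 / d / 8 + t / (4 * d) := by field_simp; ring
      have h4 : t / (4 * d) ≤ 1 := by rw [div_le_one (by positivity)]; linarith
      linarith
    · have hA : 0 ≤ (if d - t ≤ 0 then 0 else (√(log (1 / min (d - t) d₀)))⁻¹) := by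
        split_ifs with h
        · exact le_rfl
        · exact inv_nonneg.2 (Real.sqrt_nonneg _)
      have hti : t⁻¹ ≤ 2 * (1 / d) := by
        rw [← div_eq_mul_one_div, inv_le_comm₀ ht (by positivity), inv_div]; linarith
      have h2 := mul_le_mul hρ.2 hW.2 hW.1 (by positivity)
      linarith [mul_nonneg hρ0 hA, mul_nonneg hρ0 hB.1]

/-- **The surplus estimate** with explicit constants `c = 1/2`, `C = 4`. -/
private theorem surplus_main {d₀ δ d : ℝ} (hd₀ : 0 < d₀) (hd₀' : d₀ ≤ 1 / 16) (hδ : 2 * d₀ ≤ δ)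
    (hδ1 : δ ≤ 1) (hd : 0 < d) (hdd₀ : d < d₀) :
    1 / 2 * √(log (1 / d₀)) - 4 * (1 + log (1 / δ)) ≤
      ∫ t in Ioc (0 : ℝ) δ, weilArchDensity t * (2 * (√(log (1 / min d d₀)))⁻¹
        - (if d - t ≤ 0 then 0 else (√(log (1 / min (d - t) d₀)))⁻¹) - (√(log (1 / min (d + t) d₀)))⁻¹) := by
  have hdδ : d ≤ δ := by linarith
  have hFint := surplus_integrableOn hd hdd₀ hd₀' hδ1
  rw [← Ioc_union_Ioc_eq_Ioc hd.le hdδ, setIntegral_union (Ioc_disjoint_Ioc_of_le le_rfl)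
    measurableSet_Ioc (hFint.mono_set (Ioc_subset_Ioc_right hdδ))
    (hFint.mono_set (Ioc_subset_Ioc_left hd.le))]
  have h0 := setIntegral_mono_on
    (integrableOn_const (C := -(1 / (16 * d) + 1 / 8)) (hs := measure_Ioc_lt_top.ne))
    (hFint.mono_set (Ioc_subset_Ioc_right hdδ)) measurableSet_Ioc
    fun t ht ↦ surplus_pt0 hd hdd₀ hd₀' ht.1 ht.2
  rw [setIntegral_const, Real.volume_real_Ioc_of_le hd.le, smul_eq_mul,
    show (d - 0) * -(1 / (16 * d) + 1 / 8) = -(1 / 16 + d / 8) by field_simp; ring] at h0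
  have hLL₀ : log (1 / d₀) ≤ log (1 / d) :=
    Real.log_le_log (by positivity) (one_div_le_one_div_of_le hd hdd₀.le)
  have hΛ0 : 0 ≤ log (1 / δ) := Real.log_nonneg (one_le_one_div (by linarith) hδ1)
  have hb₀ := surplus_ell_bounds hd₀ hd₀'
  have hsLL : √(log (1 / d₀)) ≤ √(log (1 / d)) := Real.sqrt_le_sqrt hLL₀
  have hL₀pos : 0 < log (1 / d₀) := Real.sqrt_pos.1 (by linarith [hb₀.1])
  have f1 : (√(log (1 / d)))⁻¹ * log (1 / d) = √(log (1 / d)) := by rw [inv_mul_eq_div, Real.div_sqrt]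
  have f2 : (√(log (1 / d₀)))⁻¹ * log (1 / d₀) = √(log (1 / d₀)) := by
    rw [inv_mul_eq_div, Real.div_sqrt]
  have f3 : (√(log (1 / d)))⁻¹ * log (1 / δ) ≤ (√(log (1 / d₀)))⁻¹ * log (1 / δ) :=
    mul_le_mul_of_nonneg_right (inv_anti₀ (Real.sqrt_pos.2 hL₀pos) hsLL) hΛ0
  have f4 : (√(log (1 / d₀)))⁻¹ * log (1 / δ) ≤ 5 / 8 * log (1 / δ) :=
    mul_le_mul_of_nonneg_right hb₀.2.2 hΛ0
  have f6 : (√(log (1 / d₀)))⁻¹ * log 2 ≤ 5 / 8 * 0.6931471808 :=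
    mul_le_mul hb₀.2.2 Real.log_two_lt_d9.le (Real.log_nonneg one_le_two) (by norm_num)
  have f7 : (√(log (1 / d₀)))⁻¹ * (δ - d) ≤ (√(log (1 / d₀)))⁻¹ :=
    mul_le_of_le_one_right (inv_nonneg.2 (Real.sqrt_nonneg _)) (by linarith)
  have hlog2 : log (1 / (d₀ / 2)) = log (1 / d₀) + log 2 := by
    rw [one_div, one_div, Real.log_inv, Real.log_inv, Real.log_div hd₀.ne' two_ne_zero]; ring
  -- `W̃(d + t) ≤ W(d₀)` on `(a, δ]` for `d ≤ a`
  have hBw : ∀ {a t : ℝ}, d ≤ a → t ∈ Ioc a δ →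
      (√(log (1 / min (d + t) d₀)))⁻¹ ≤ (√(log (1 / d₀)))⁻¹ := fun ha ht ↦
    surplus_W_mono (lt_min (by linarith [ht.1]) (hd.trans hdd₀)) (min_le_right _ _) (by linarith)
  rcases le_or_gt (d₀ / 2) d with hcase | hcase
  · -- case `d ≥ d₀/2`: `Ŵ ≡ W(d₀)` on `(d, δ]`
    have h1 := surplus_block1 hd hdδ (hFint.mono_set (Ioc_subset_Ioc_left hd.le))
      fun t ht ↦ surplus_pt1 hd hdd₀ hd₀' ht.1 (ht.2.trans hδ1) (hBw le_rfl ht)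
    have f5 : log (1 / d) ≤ log (1 / d₀) + log 2 := by
      rw [← hlog2]
      exact Real.log_le_log (by positivity) (one_div_le_one_div_of_le (by positivity) hcase)
    have f5' : (√(log (1 / d₀)))⁻¹ * log (1 / d) ≤ (√(log (1 / d₀)))⁻¹ * (log (1 / d₀) + log 2) :=
      mul_le_mul_of_nonneg_left f5 (inv_nonneg.2 (Real.sqrt_nonneg _))
    nlinarith [hb₀.1, hb₀.2.2]
  · -- case `d < d₀/2`: split `(d, δ]` at `d₀/2`
    have hd₀δ : d₀ / 2 ≤ δ := by linarith
    rw [← Ioc_union_Ioc_eq_Ioc hcase.le hd₀δ, setIntegral_union (Ioc_disjoint_Ioc_of_le le_rfl)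
      measurableSet_Ioc (hFint.mono_set (Ioc_subset_Ioc hd.le hd₀δ))
      (hFint.mono_set (Ioc_subset_Ioc_left (by linarith)))]
    have h1 := surplus_block2 hd hcase.le (by linarith) (hFint.mono_set (Ioc_subset_Ioc hd.le hd₀δ))
      fun t ht ↦ surplus_pt1 hd hdd₀ hd₀' ht.1 (by linarith [ht.2]) (surplus_W_mono
        (lt_min (by linarith [ht.1]) (hd.trans hdd₀)) ((min_le_left _ _).trans (by linarith [ht.1]))
        (by linarith [ht.2]))
    have h2 := surplus_block1 (by positivity) hd₀δ
      (hFint.mono_set (Ioc_subset_Ioc_left (by linarith)))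
      fun t ht ↦ surplus_pt1 hd hdd₀ hd₀' (hcase.trans ht.1) (ht.2.trans hδ1) (hBw hcase.le ht)
    rw [hlog2, show (2 : ℝ) * (d₀ / 2) = d₀ by ring] at h1
    rw [hlog2] at h2
    have hs2 : √(log (1 / (2 * d))) ≤ √(log (1 / d)) :=
      Real.sqrt_le_sqrt (Real.log_le_log (by positivity) (one_div_le_one_div_of_le hd (by linarith)))
    nlinarith [hb₀.1, hb₀.2.2]

/-- **Sub-stub P1 `stub_edgeLaw_surplus` — the borderline barrier surplus (pure real analysis).**
For the two-scale profile `W̃(s) = (log(1/min(s,d₀)))^(-1/2)` (`s > 0`; `0` for `s ≤ 0`, i.e. outside the window) the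
δ-localised archimedean operator has a surplus `≥ c√(log 1/d₀) − C(1 + log(1/δ))` at every depth `0 < d < d₀` of the layer
(`2 d₀ ≤ δ ≤ 1`): the outward killing `W̃(d)∫_d^δ ρ` and the inward pull `∫_0^δ (W̃(d+t) − W̃(d)) ρ(t) dt` both carry the
critical `½√(log 1/d)`, which cancel exactly (`ρ = 1/(2t) + O(1)` on `(0,1]`, `abs_weilArchDensity_sub_le`; `log(1+x) ≤ x`;
`∫ (log 1/s)^(-1/2) ds/s = −2√(log 1/s)`). Model in print: HS–LR–S arXiv:2401.18033 Thm 2.4. Here `c = 1/2`, `C = 4`. -/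
theorem stub_edgeLaw_surplus :
    ∃ c C : ℝ, 0 < c ∧ ∀ d₀ δ : ℝ, 0 < d₀ → d₀ ≤ 1 / 16 → 2 * d₀ ≤ δ → δ ≤ 1 →
      ∀ d : ℝ, 0 < d → d < d₀ →
        c * Real.sqrt (Real.log (1 / d₀)) - C * (1 + Real.log (1 / δ)) ≤
          ∫ t in Ioc (0 : ℝ) δ, weilArchDensity t *
            ((2 : ℝ) * (Real.sqrt (Real.log (1 / min d d₀)))⁻¹
              - (if d - t ≤ 0 then 0 else (Real.sqrt (Real.log (1 / min (d - t) d₀)))⁻¹)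
              - (Real.sqrt (Real.log (1 / min (d + t) d₀)))⁻¹) :=
  ⟨1 / 2, 4, by norm_num, fun _ _ hd₀ hd₀' hδ hδ1 _ hd hdd₀ ↦ surplus_main hd₀ hd₀' hδ hδ1 hd hdd₀⟩

end Summit.RiemannHypothesis.RiemannHypothesis.Theorems.WeilWindowFlowWindowLipschitz

end
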